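import Summits.AtomisticToContinuum.BoseEinsteinCondensation.Theorems.BECRewardDescentRewardChordBoundChordFromModulus
import Summits.AtomisticToContinuum.BoseEinsteinCondensation.Theorems.BECRewardDescentRewardChordBoundSecantWalkReal

/-!
# Crux `RewardChordBound` (stmt-AtomisticToContinuum-12876) — the one-shell inequality FROM the pointwise modulus
# (abstract form; helper for `ShellModulus ⇐ SectorGap ∧ CondensateVariance`, line `dyadic-secant` vs line `registered`)

Helper file (does not close the item). The registered line `Lines/birth.lean` reduces the crux to the Bogoliubov pair
`SectorGap ∧ CondensateVariance` (items 12874/12875) through a POINTWISE concavity-modulus bound of the reward curve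
(`stub_modulusOfSimple`: `2R(s) ≤ R(s+h) + R(s−h) + 2h²CN/(c√(ρa s) − 2hN)` wherever near-minimisers are condensed) and
the no-kink property (`stub_noKinkOfSimple`); the strategist's line `dyadic-secant` reduces it instead to the ONE-SHELL
three-energy inequality `3R(2u) ≤ 2R(u) + R(4u) + KNu√(u/(ρa))` (`stub_shellModulus`). This file proves, for an abstract
family `i ↦ Eᵢ + t·Dᵢ` in `ℝ≥0∞` (exactly the hypotheses of `Birth.stub_chordFromModulusAffineWalk`), that the pointwise
modulus + no kink + the CHORD BOUND itself (with `τ = η/2`) + the rung give the one-shell inequality with `K = 5C/c` on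
every shell `4u ≤ S₀ ≤ min(s₀, ρa)`:

* `real_chord_of_ennreal_chord` — the subtraction-free `ℝ≥0∞` chord inequality back to real slopes;
* `ennreal_shell_of_real` — the real one-shell inequality back to `ℝ≥0∞`;
* `shell_of_modulus_affine` — the theorem: (i) chord bound + rung ⇒ `σ(0,s) ≤ (3η/4)N` on `(0, s₀]` ⇒ (Griffiths,
  `WalkGlue.near_min_le_leftDeriv_add`) near-minimisers are condensed at EVERY `s ∈ (0, s₀]`; (ii) hence the modulus fires
  everywhere and gives `R(t+h) + R(t−h) − 2R(t) ≥ −(2A/√t + ε)h²` frequently as `h → 0⁺` (`A = CN/(c√(ρa))`); (iii) with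
  `G(t) = (8A/3)t√t` (`G'' = 2A/√t`), `R + G` is convex on `[u, 4u]` (`WalkGlue.convexOn_Icc_of_symmDiff`,
  `symmDiff_taylor`), and the three-point inequality of convexity at `2u = (2/3)u + (1/3)4u` is the shell inequality with
  allowance `(80/3 − 16√2)A·u√u ≤ 5A·u√u` (`7/5 ≤ √2`).

So whatever proves the registered line's two Bogoliubov cruxes proves the shell stub: the assembled statement
`ShellModulus ⇐ SectorGap ∧ CondensateVariance` is `BECRewardDescentRewardChordBoundShellOfGapVar.lean`.

References: [Griffiths1966] §III (concavity in a coupling, near-minimiser slopes); [Kato1966] VII §3 (second-order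
bounds); route text of BECRewardDescent; strategist card `Cruxes/RewardChordBound/Lines/dyadic-secant.md`.
-/

noncomputable section

open Set Filter Topology
open scoped ENNReal

namespace Summit.AtomisticToContinuum.BoseEinsteinCondensation.Cruxes.RewardChordBound.DyadicSecant

open Summit.AtomisticToContinuum.BoseEinsteinCondensation.Theorems.WalkGlue
open Summit.AtomisticToContinuum.BoseEinsteinCondensation.Cruxes.RewardChordBound.Birth.ChordFromModulus

namespace ShellOfModulus

/-- **The `ℝ≥0∞` chord inequality back to real slopes.** `R(s) + (s/s₀)R(0) ≤ R(0) + (s/s₀)R(s₀) + sτN` with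
everything finite gives `chord(s) ≤ chord(s₀) + τN` for the real curve. [folklore] -/
theorem real_chord_of_ennreal_chord {Rₑ : ℝ → ℝ≥0∞} {s s₀ τ N : ℝ} (hs : 0 < s) (hs₀ : 0 < s₀)
    (hτN : 0 ≤ τ * N) (h0 : Rₑ 0 ≠ ⊤) (hs' : Rₑ s ≠ ⊤) (hs₀' : Rₑ s₀ ≠ ⊤)
    (h : Rₑ s + ENNReal.ofReal (s / s₀) * Rₑ 0 ≤
      Rₑ 0 + ENNReal.ofReal (s / s₀) * Rₑ s₀ + ENNReal.ofReal (s * τ * N)) :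
    slope (fun t => (Rₑ t).toReal) 0 s ≤ slope (fun t => (Rₑ t).toReal) 0 s₀ + τ * N := by
  have hq : 0 ≤ s / s₀ := by positivity
  have hsτ : 0 ≤ s * τ * N := by rw [mul_assoc]; exact mul_nonneg hs.le hτN
  have hm0 : ENNReal.ofReal (s / s₀) * Rₑ 0 ≠ ⊤ := ENNReal.mul_ne_top ENNReal.ofReal_ne_top h0
  have hm₀ : ENNReal.ofReal (s / s₀) * Rₑ s₀ ≠ ⊤ := ENNReal.mul_ne_top ENNReal.ofReal_ne_top hs₀'
  have hR : Rₑ 0 + ENNReal.ofReal (s / s₀) * Rₑ s₀ + ENNReal.ofReal (s * τ * N) ≠ ⊤ :=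
    ENNReal.add_ne_top.2 ⟨ENNReal.add_ne_top.2 ⟨h0, hm₀⟩, ENNReal.ofReal_ne_top⟩
  have h' := ENNReal.toReal_mono hR h
  rw [ENNReal.toReal_add hs' hm0, ENNReal.toReal_add (ENNReal.add_ne_top.2 ⟨h0, hm₀⟩) ENNReal.ofReal_ne_top,
    ENNReal.toReal_add h0 hm₀, ENNReal.toReal_ofReal_mul _ _ hq, ENNReal.toReal_ofReal_mul _ _ hq,
    ENNReal.toReal_ofReal hsτ] at h'
  rw [slope_def_field, slope_def_field, sub_zero, sub_zero, div_le_iff₀ hs]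
  have hid : (((Rₑ s₀).toReal - (Rₑ 0).toReal) / s₀ + τ * N) * s =
      s / s₀ * (Rₑ s₀).toReal - s / s₀ * (Rₑ 0).toReal + s * τ * N := by ring
  rw [hid]
  linarith

/-- **The real one-shell inequality back to `ℝ≥0∞`.** [folklore] -/
theorem ennreal_shell_of_real {a b c : ℝ≥0∞} {x : ℝ} (ha : a ≠ ⊤) (hb : b ≠ ⊤) (hc : c ≠ ⊤) (hx : 0 ≤ x)
    (h : 3 * a.toReal ≤ 2 * b.toReal + c.toReal + x) : 3 * a ≤ 2 * b + c + ENNReal.ofReal x := by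
  have h' := ENNReal.ofReal_le_ofReal h
  rw [ENNReal.ofReal_mul (by norm_num : (0 : ℝ) ≤ 3), ENNReal.ofReal_toReal ha,
    ENNReal.ofReal_add (by positivity) hx, ENNReal.ofReal_add (by positivity) ENNReal.toReal_nonneg,
    ENNReal.ofReal_mul (by norm_num : (0 : ℝ) ≤ 2), ENNReal.ofReal_toReal hb, ENNReal.ofReal_toReal hc] at h'
  simpa using h'

/-- **The one-shell inequality from the pointwise modulus (abstract form).** For a family `i ↦ Eᵢ + t·Dᵢ` in `ℝ≥0∞`
with `Dᵢ ≤ N`, `⨅ Eᵢ < ∞`, reward curve `R(t) = ⨅ᵢ (Eᵢ + t·Dᵢ)` and a predicate `P` implied by `Dᵢ < ηN`: IF (rung)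
`R(s₀) ≤ ⨅E + s₀(η/4)N`, (chord) `R(s) + (s/s₀)⨅E ≤ ⨅E + (s/s₀)R(s₀) + s(η/2)N` on `(0, s₀]`, (no kink) at every `s > 0`,
and (modulus) at every `s ∈ (0, ρa]`, `h ∈ (0, s)` with `2hN < c√(ρa)√s` whenever the near-minimisers of `Eᵢ + s·Dᵢ`
satisfy `P`, THEN on every shell `(u, 4u]` with `4u ≤ S₀ ≤ min(s₀, ρa)`:
`3R(2u) ≤ 2R(u) + R(4u) + (5C/c)·N·u·√(u/(ρa))`. [folklore] -/
theorem shell_of_modulus_affine :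
    ∀ (ι : Type) (E D : ι → ENNReal) (P : ι → Prop) (Rₑ : ℝ → ENNReal) (N : ℕ) (η c C s₀ S₀ ρ a : ℝ),
      (∀ t : ℝ, Rₑ t = ⨅ i, (E i + ENNReal.ofReal t * D i)) → 0 < η → 0 < c → 0 ≤ C →
      0 < S₀ → S₀ ≤ s₀ → S₀ ≤ ρ * a →
      (∀ i, D i ≤ (N : ENNReal)) → (⨅ i, E i) ≠ ⊤ → (∀ i, D i < ENNReal.ofReal (η * N) → P i) →
      (Rₑ s₀ ≤ (⨅ i, E i) + ENNReal.ofReal (s₀ * (η / 4) * N)) →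
      (∀ s : ℝ, 0 < s → s ≤ s₀ → Rₑ s + ENNReal.ofReal (s / s₀) * (⨅ i, E i) ≤
        (⨅ i, E i) + ENNReal.ofReal (s / s₀) * Rₑ s₀ + ENNReal.ofReal (s * (η / 2) * N)) →
      (∀ s : ℝ, 0 < s → ∀ ε : ℝ, 0 < ε → ∃ h₀ : ℝ, 0 < h₀ ∧ ∀ h : ℝ, 0 < h → h < h₀ →
        2 * Rₑ s ≤ Rₑ (s + h) + Rₑ (s - h) + ENNReal.ofReal (ε * h)) →
      (∀ s h : ℝ, 0 < h → h < s → s ≤ ρ * a → 2 * h * N < c * Real.sqrt (ρ * a) * Real.sqrt s →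
        (∃ δ : ENNReal, 0 < δ ∧ ∀ i, E i + ENNReal.ofReal s * D i ≤ Rₑ s + δ → P i) →
        2 * Rₑ s ≤ Rₑ (s + h) + Rₑ (s - h) + ENNReal.ofReal
          (2 * h ^ 2 * (C * N) / (c * Real.sqrt (ρ * a) * Real.sqrt s - 2 * h * N))) →
      ∀ u : ℝ, 0 < u → 4 * u ≤ S₀ →
        3 * Rₑ (2 * u) ≤ 2 * Rₑ u + Rₑ (4 * u) +
          ENNReal.ofReal (5 * C / c * N * u * Real.sqrt (u / (ρ * a))) := by
  intro ι E D P Rₑ N η c C s₀ S₀ ρ a hRdef hη hc hC hS₀ hS₀s hS₀a hD hE hP hrung hchord hkink hmod u hu h4u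
  have hN : (N : ℝ≥0∞) ≠ ⊤ := ENNReal.natCast_ne_top N
  have hfin : ∀ t, Rₑ t ≠ ⊤ := fun t => (hRdef t).symm ▸ iInf_affine_ne_top E D hD hN hE t
  have hR0 : Rₑ 0 = ⨅ i, E i := (hRdef 0).trans (iInf_affine_zero E D)
  have hs₀ : 0 < s₀ := hS₀.trans_le hS₀s
  have hρa : 0 < ρ * a := hS₀.trans_le hS₀a
  have hX0 : 0 ≤ 5 * C / c * N * u * Real.sqrt (u / (ρ * a)) := by positivity
  -- no particles: the curve is constant
  rcases Nat.eq_zero_or_pos N with hN0 | hNpos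
  · subst hN0
    have hD0 : ∀ i, D i = 0 := fun i => le_antisymm ((hD i).trans (by simp)) bot_le
    have hconst : ∀ t, Rₑ t = ⨅ i, E i := fun t => by simp [hRdef, hD0]
    rw [hconst, hconst, hconst]
    calc 3 * (⨅ i, E i) = 2 * (⨅ i, E i) + (⨅ i, E i) := by ring
      _ ≤ _ := le_self_add
  have hNr : (0 : ℝ) < N := Nat.cast_pos.2 hNpos
  -- the real curve
  obtain ⟨Rr, hRr⟩ : ∃ Rr : ℝ → ℝ, ∀ t, (Rₑ t).toReal = Rr t := ⟨_, fun _ => rfl⟩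
  have hconc : ConcaveOn ℝ (Ici 0) Rr := by
    have h := concaveOn_toReal_iInf_affine E D hD hN hE
    simp only [← hRdef, hRr] at h
    exact h
  -- no kink: the real curve is differentiable on `(0, ∞)`
  have hdiff : ∀ t : ℝ, 0 < t → DifferentiableAt ℝ Rr t := by
    intro t ht
    refine differentiableAt_of_noKink hconc ht fun ε hε => ?_
    obtain ⟨h₀, hh₀, hk⟩ := hkink t ht ε hε
    have hlt₁ : min (h₀ / 2) (t / 2) < h₀ := (min_le_left _ _).trans_lt (half_lt_self hh₀)
    have hlt₂ : min (h₀ / 2) (t / 2) < t := (min_le_right _ _).trans_lt (half_lt_self ht)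
    have hpos : 0 < min (h₀ / 2) (t / 2) := lt_min (half_pos hh₀) (half_pos ht)
    refine ⟨min (h₀ / 2) (t / 2), hpos, hlt₂, ?_⟩
    have h := toReal_two_mul_le (hfin _) (hfin _) (by positivity) (hk _ hpos hlt₁)
    simpa only [hRr] using h
  -- rung + chord bound: every chord slope on `(0, s₀]` is below `(3η/4)N`
  have hrungR : slope Rr 0 s₀ ≤ η / 4 * N := by
    have h := slope_le_of_ennreal_rung (Rₑ := Rₑ) (τ := η / 4) (N := (N : ℝ)) hs₀ (by positivity)
      (hfin 0) (by rw [hR0]; exact hrung)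
    simpa only [hRr] using h
  have hchordR : ∀ s, 0 < s → s ≤ s₀ → slope Rr 0 s ≤ 3 * η / 4 * N := by
    intro s hs hss
    have h := real_chord_of_ennreal_chord (Rₑ := Rₑ) (τ := η / 2) (N := (N : ℝ)) hs hs₀ (by positivity)
      (hfin 0) (hfin s) (hfin s₀) (by rw [hR0]; exact hchord s hs hss)
    simp only [hRr] at h
    linarith
  -- Griffiths: the near-minimisers are condensed at EVERY reward `s ∈ (0, s₀]`
  have hcond : ∀ s, 0 < s → s ≤ s₀ →
      ∃ δ : ℝ≥0∞, 0 < δ ∧ ∀ i, E i + ENNReal.ofReal s * D i ≤ Rₑ s + δ → P i := by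
    intro s hs0 hss
    obtain ⟨δ', hδ', hG⟩ :=
      near_min_le_leftDeriv_add hconc hs0 (ε := η * N / 8) (by positivity)
    refine ⟨ENNReal.ofReal δ', ENNReal.ofReal_pos.2 hδ', fun i hi => hP i ?_⟩
    have hDi : D i ≠ ⊤ := ne_top_of_le_ne_top hN (hD i)
    have hsum : E i + ENNReal.ofReal s * D i ≠ ⊤ :=
      ne_top_of_le_ne_top (ENNReal.add_ne_top.2 ⟨hfin s, ENNReal.ofReal_ne_top⟩) hi
    have hEi : E i ≠ ⊤ := (ENNReal.add_ne_top.1 hsum).1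
    have hmin : ∀ t : ℝ, 0 ≤ t → Rr t ≤ (E i).toReal + t * (D i).toReal := fun t ht => by
      rw [← hRr, hRdef]
      exact toReal_iInf_affine_le E D hD hN hEi ht
    have hnear : (E i).toReal + s * (D i).toReal ≤ Rr s + δ' := by
      have h := ENNReal.toReal_mono (ENNReal.add_ne_top.2 ⟨hfin s, ENNReal.ofReal_ne_top⟩) hi
      rwa [ENNReal.toReal_add hEi (ENNReal.mul_ne_top ENNReal.ofReal_ne_top hDi),
        ENNReal.toReal_mul, ENNReal.toReal_ofReal hs0.le,
        ENNReal.toReal_add (hfin s) ENNReal.ofReal_ne_top, ENNReal.toReal_ofReal hδ'.le,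
        hRr] at h
    have hd := hG _ _ hmin hnear
    have hld : derivWithin Rr (Iio s) s ≤ slope Rr 0 s :=
      hconc.leftDeriv_le_slope (mem_Ici.2 le_rfl) (mem_Ici.2 hs0.le) hs0
        (differentiableWithinAt_Iio_of_concaveOn hconc hs0)
    have hcs := hchordR s hs0 hss
    have hηN : 0 < η * N := mul_pos hη hNr
    exact (ENNReal.lt_ofReal_iff_toReal_lt hDi).2 (by linarith)
  -- the pointwise second-order bound at every `t ∈ (0, S₀]`
  have hc0 : c ≠ 0 := hc.ne'
  have hsqρa : 0 < Real.sqrt (ρ * a) := Real.sqrt_pos.2 hρa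
  obtain ⟨A, hA⟩ : ∃ A : ℝ, A = C * N / (c * Real.sqrt (ρ * a)) := ⟨_, rfl⟩
  have hA0 : 0 ≤ A := by rw [hA]; positivity
  have hev : ∀ t : ℝ, 0 < t → t ≤ S₀ → ∀ ε : ℝ, 0 < ε → ∃ᶠ h in 𝓝[>] (0 : ℝ),
      -((2 * (A / Real.sqrt t) + ε) * h ^ 2) ≤ Rr (t + h) + Rr (t - h) - 2 * Rr t := by
    intro t ht htS ε hε
    have hta : t ≤ ρ * a := htS.trans hS₀a
    have hcondt := hcond t ht (htS.trans hS₀s)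
    obtain ⟨g, hg⟩ : ∃ g : ℝ, c * Real.sqrt (ρ * a) * Real.sqrt t = g := ⟨_, rfl⟩
    have hgpos : 0 < g := by
      rw [← hg]
      positivity
    have hAt : A / Real.sqrt t = C * N / g := by
      have hst : Real.sqrt t ≠ 0 := (Real.sqrt_pos.2 ht).ne'
      rw [hA, ← hg]
      field_simp
    have htend : Tendsto (fun h : ℝ => 2 * (C * N) / (g - 2 * h * N)) (𝓝 0)
        (𝓝 (2 * (C * N) / g)) := by
      have h1 : Tendsto (fun h : ℝ => g - 2 * h * N) (𝓝 0) (𝓝 (g - 2 * 0 * N)) :=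
        (by fun_prop : Continuous fun h : ℝ => g - 2 * h * N).tendsto 0
      rw [mul_zero, zero_mul, sub_zero] at h1
      exact tendsto_const_nhds.div h1 hgpos.ne'
    have hev₁ : ∀ᶠ h in 𝓝 (0 : ℝ), 2 * (C * N) / (g - 2 * h * N) < 2 * (C * N) / g + ε :=
      htend (Iio_mem_nhds (by linarith))
    have hev₂ : ∀ᶠ h in 𝓝 (0 : ℝ), 2 * h * N < g := by
      have h1 : Tendsto (fun h : ℝ => 2 * h * N) (𝓝 0) (𝓝 (2 * 0 * N)) :=
        (by fun_prop : Continuous fun h : ℝ => 2 * h * N).tendsto 0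
      rw [mul_zero, zero_mul] at h1
      exact h1 (Iio_mem_nhds hgpos)
    have hev₃ : ∀ᶠ h in 𝓝[>] (0 : ℝ), 0 < h ∧ h < t := by
      filter_upwards [Ioo_mem_nhdsGT ht] with h hh using hh
    have hev' : ∀ᶠ h in 𝓝[>] (0 : ℝ),
        -((2 * (A / Real.sqrt t) + ε) * h ^ 2) ≤ Rr (t + h) + Rr (t - h) - 2 * Rr t := by
      filter_upwards [hev₃, (hev₁.and hev₂).filter_mono nhdsWithin_le_nhds] with h hh₃ hh₁₂
      obtain ⟨hh0, hht⟩ := hh₃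
      obtain ⟨hK, hhg⟩ := hh₁₂
      have hm := hmod t h hh0 hht hta (by rw [hg]; exact hhg) hcondt
      rw [hg] at hm
      have hY0 : 0 ≤ 2 * h ^ 2 * (C * N) / (g - 2 * h * N) :=
        div_nonneg (by positivity) (by linarith)
      have hr := toReal_two_mul_le (hfin _) (hfin _) hY0 hm
      simp only [hRr] at hr
      have hK' : 2 * (C * N) / (g - 2 * h * N) ≤ 2 * (C * N / g) + ε := by
        rw [← mul_div_assoc]
        exact hK.le
      have hYle : 2 * h ^ 2 * (C * N) / (g - 2 * h * N) ≤ (2 * (A / Real.sqrt t) + ε) * h ^ 2 := by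
        rw [hAt]
        calc 2 * h ^ 2 * (C * N) / (g - 2 * h * N)
            = 2 * (C * N) / (g - 2 * h * N) * h ^ 2 := by ring
          _ ≤ (2 * (C * N / g) + ε) * h ^ 2 := mul_le_mul_of_nonneg_right hK' (sq_nonneg h)
      linarith
    exact hev'.frequently
  -- `R + G` is convex on `[u, 4u]`, `G(t) = (8A/3)t√t`
  obtain ⟨φ, hφ⟩ : ∃ φ : ℝ → ℝ, φ = fun t => Rr t + 8 * A / 3 * (t * Real.sqrt t) := ⟨_, rfl⟩
  have hRcont := continuousOn_Ioi_of_concaveOn hconc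
  have hGcont : Continuous fun t : ℝ => 8 * A / 3 * (t * Real.sqrt t) :=
    continuous_const.mul (continuous_id.mul Real.continuous_sqrt)
  have hφcont : ContinuousOn φ (Icc u (4 * u)) := by
    rw [hφ]
    exact (hRcont.mono fun t ht => hu.trans_le ht.1).add hGcont.continuousOn
  have hconv : ConvexOn ℝ (Icc u (4 * u)) φ := by
    refine convexOn_Icc_of_symmDiff hφcont fun t ht ε hε => ?_
    have ht0 : 0 < t := hu.trans ht.1
    have hGt : ∀ᶠ t' in 𝓝 t, HasDerivAt (fun x => 8 * A / 3 * (x * Real.sqrt x)) (4 * A * Real.sqrt t') t' := by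
      filter_upwards [Ioi_mem_nhds ht0] with t' ht' using hasDerivAt_sqrt_potential A ht'
    have hB := symmDiff_taylor hGt (hasDerivAt_sqrt_budget A ht0) (ε / 2) (half_pos hε)
    refine ((hev t ht0 (ht.2.le.trans h4u) (ε / 2) (half_pos hε)).and_eventually hB).mono
      fun h hh => ?_
    have h2 := (abs_le.1 hh.2).1
    have hid : φ (t + h) + φ (t - h) - 2 * φ t = (Rr (t + h) + Rr (t - h) - 2 * Rr t) +
        (8 * A / 3 * ((t + h) * Real.sqrt (t + h)) + 8 * A / 3 * ((t - h) * Real.sqrt (t - h)) -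
          2 * (8 * A / 3 * (t * Real.sqrt t))) := by
      rw [hφ]
      ring
    rw [hid]
    nlinarith [hh.1, h2]
  -- the three-point inequality of convexity at `2u = (2/3)u + (1/3)(4u)`
  have h3pt := hconv.2 (left_mem_Icc.2 (by linarith)) (right_mem_Icc.2 (by linarith))
    (show (0 : ℝ) ≤ 2 / 3 by norm_num) (show (0 : ℝ) ≤ 1 / 3 by norm_num) (by norm_num)
  simp only [smul_eq_mul, hφ] at h3pt
  have hs4 : Real.sqrt (4 * u) = 2 * Real.sqrt u := by
    rw [Real.sqrt_mul (by norm_num : (0 : ℝ) ≤ 4), show Real.sqrt 4 = 2 by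
      rw [show (4 : ℝ) = 2 ^ 2 by norm_num, Real.sqrt_sq (by norm_num)]]
  rw [show (2 : ℝ) / 3 * u + 1 / 3 * (4 * u) = 2 * u by ring, hs4,
    Real.sqrt_mul (by norm_num : (0 : ℝ) ≤ 2) u] at h3pt
  -- the real shell inequality with allowance `(80/3 − 16√2)A·u√u ≤ 5A·u√u`
  have hW0 : 0 ≤ A * (u * Real.sqrt u) := by positivity
  have h72 := mul_le_mul_of_nonneg_right SecantWalk.seven_fifths_le_sqrt_two hW0
  have hAu : 5 * C / c * N * u * Real.sqrt (u / (ρ * a)) = 5 * (A * (u * Real.sqrt u)) := by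
    rw [Real.sqrt_div' u hρa.le, hA]
    field_simp
  have hreal : 3 * Rr (2 * u) ≤ 2 * Rr u + Rr (4 * u) + 5 * C / c * N * u * Real.sqrt (u / (ρ * a)) := by
    rw [hAu]
    nlinarith [h3pt, h72]
  rw [← hRr, ← hRr, ← hRr] at hreal
  exact ennreal_shell_of_real (hfin _) (hfin _) (hfin _) hX0 hreal

end ShellOfModulus

end Summit.AtomisticToContinuum.BoseEinsteinCondensation.Cruxes.RewardChordBound.DyadicSecant

end
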